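import Summits.Schanuel.Schanuel.Theorems.DiophantineDichotomyKhovanskiiApproxTypeEvAnchoredReduction
import Summits.Schanuel.Schanuel.Theorems.DiophantineDichotomyKhovanskiiApproxTypeEvUnanchoring
import Summits.Schanuel.Schanuel.Theorems.DiophantineDichotomyKhovanskiiApproxTypeEvRaceAnchored
import Summits.Schanuel.Schanuel.Theorems.DiophantineDichotomyKhovanskiiApproxTypeEvFlagship
import Summits.Schanuel.Schanuel.Theorems.DiophantineDichotomyEPiSimultaneousTypeStrength
import Summits.Schanuel.Schanuel.Theorems.DiophantineDichotomyApproximationPropertyDegOne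
import HarnessLib

/-!
# Route `DiophantineDichotomy`, crux `KhovanskiiApproxTypeEv`, line `anchored-reduction`:
# the anchored deciding chain and the hardness certificates of the two open stubs

Crux `Summit.Schanuel.Schanuel.Theses.DiophantineDichotomy.KhovanskiiApproxTypeEv`
(item stmt-Schanuel-14972), line `anchored-reduction` (skeleton `Cruxes/KhovanskiiApproxTypeEv/
Lines/Sketch.lean`, v4, leads `prover-line-stmt-Schanuel-14972-0`, `…-c1-0`, `…-c2-0`), registered
sub-goal `schanuel_of_anchored` (`--supports stmt-Schanuel-14972`; the first submission p112890 was lost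
to a gate restart and is re-assembled here by the lead c2 from the LANDED stubs).

## Contents (all implications; nothing is credited to the summit)

* `reductionAnchored : KhovanskiiReductionAnchored` — Schanuel's conjecture follows from Schanuel at
  ANCHORED free Khovanskii points `s = (1, iπ, s₂, …)` (`stub_unanchoring ∘ stub_anchoredReduction`,
  p107263 ∘ p105406).
* `evAnchored_of_ev`, `schanuel_of_ev` — the crux as filed trivially gives the anchored crux, hence
  (with `ApproximationProperty`) Schanuel through the anchored chain.
* `schanuel_of_anchored : ApproximationProperty → KhovanskiiApproxTypeEvAnchored → Schanuel` — the
  route's deciding chain restricted to the anchored family (`reductionAnchored ∘ stub_raceAnchored`,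
  p111284): the ROUTE needs the Diophantine crux only on `s = (1, iπ, s₃, …)`.
* `evAnchored_of_flagship_of_rankThreeUp`, `schanuel_of_flagship_of_rankThreeUp` — on the anchored
  family the whole `n = 2` need is the single route item `EPiSimultaneousTypeEv` (stmt-Schanuel-14975,
  glue `evAnchored_two_of_flagship` p112678); ranks `≥ 3` are the skeleton's stub `EvRankThreeUp`.
* HARDNESS CERTIFICATES of the skeleton's two open stubs (why the lead hands them back as crux-sized):
  `expOnePiAlgebraicIndependent_of_evNonLWTwo : EvNonLWTwo → ExpOnePiAlgebraicIndependent` —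
  UNCONDITIONAL: a proof of stub 6 is a proof of the algebraic independence of `e` and `π`
  (`flagship_of_evNonLW_two` p113183, the PROVED eventual race `ePiRaceEv_proof` and the PROVED level-one
  approximation property `approximationPropertyDegOne_proof`); and
  `schanuel_of_approximationProperty_of_stubs : ApproximationProperty → EvNonLWTwo → EvRankThreeUp →
  Schanuel` — modulo Philippon's approximation property (the route's other crux) the two open stubs
  are ALL of Schanuel's conjecture.
-/

noncomputable section

-- `Summit.Schanuel.Schanuel.…` is the mandated summit/sub-problem namespace (single-conjunct summit), hence:
set_option linter.dupNamespace false

namespace Summit.Schanuel.Schanuel.Cruxes.KhovanskiiApproxTypeEv.AnchoredReduction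

open Summit.Schanuel.Schanuel.Theses.DiophantineDichotomy
  (KhovanskiiApproxTypeEv ApproximationProperty ApproximationPropertyDegOne EPiSimultaneousTypeEv)
open Summit.Schanuel.Schanuel.Cruxes.KhovanskiiApproxType.LwSmallHeight (IsFreeKhovanskii)
open Summit.Schanuel.Schanuel.Theorems
  (approximationPropertyDegOne_proof expOnePiAlgebraicIndependent_of_degOne_of_epiSimultaneousTypeEv)

/-! ## The anchored deciding chain -/

/-- **The anchored reduction** (`KhovanskiiReductionAnchored`, the card's first lemma): Schanuel's
conjecture follows from Schanuel at anchored free Khovanskii points `s = (1, iπ, s₂, …)` — the landed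
stubs `stub_anchoredReduction : KhovanskiiSchanuelAnchored → SchanuelAnchored` (anchored Kirby/Ax
induction) and `stub_unanchoring : SchanuelAnchored → Schanuel` (adjoin the anchors), composed. [folklore] -/
theorem reductionAnchored : KhovanskiiReductionAnchored :=
  fun h => stub_unanchoring (stub_anchoredReduction h)

/-- The crux as filed gives the anchored crux (instance `n + 2`, forgetting the anchors). [folklore] -/
theorem evAnchored_of_ev (hEv : KhovanskiiApproxTypeEv) : KhovanskiiApproxTypeEvAnchored := by
  intro n s _h0 _h1 hs hfree
  exact khovanskiiApproxTypeEv_iff.1 hEv (n + 2) s (by omega) hs hfree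

/-- **Registered sub-goal `schanuel_of_anchored` of line `anchored-reduction`** — the route's deciding
chain restricted to the anchored family: Philippon's approximation property and the eventual
simultaneous-approximation crux at ANCHORED free Khovanskii points `s = (1, iπ, s₂, …)` already give
Schanuel's conjecture (`reductionAnchored ∘ stub_raceAnchored`).  So the route consumes the Diophantine
crux `KhovanskiiApproxTypeEv` only on the anchored family. [folklore] -/
theorem schanuel_of_anchored : ApproximationProperty → KhovanskiiApproxTypeEvAnchored → _root_.Schanuel :=
  fun hAP hEv => reductionAnchored (stub_raceAnchored hAP hEv)

/-- The route's deciding chain through the anchored family: Philippon's approximation property and the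
crux AS FILED give Schanuel's conjecture (`schanuel_of_anchored ∘ evAnchored_of_ev`; the same conclusion as
the route's `Assembly` with `KhovanskiiApproxTypeEv` in place of `KhovanskiiApproxType`). [folklore] -/
theorem schanuel_of_ev : ApproximationProperty → KhovanskiiApproxTypeEv → _root_.Schanuel :=
  fun hAP hEv => schanuel_of_anchored hAP (evAnchored_of_ev hEv)

/-- On the anchored family, the `n = 2` layer is the flagship route item `EPiSimultaneousTypeEv`
(stmt-Schanuel-14975; glue `evAnchored_two_of_flagship`) and the ranks `≥ 3` are the skeleton's
residual stub `EvRankThreeUp`. [folklore] -/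
theorem evAnchored_of_flagship_of_rankThreeUp (hF : EPiSimultaneousTypeEv) (hR : EvRankThreeUp) :
    KhovanskiiApproxTypeEvAnchored := by
  intro n s h0 h1 hs hfree
  cases n with
  | zero => exact evAnchored_two_of_flagship hF s h0 h1
  | succ m => exact hR (m + 1 + 2) s (by omega) hs hfree

/-- **The route modulo its two open Diophantine inputs on the anchored family**: Philippon's
approximation property, the flagship `EPiSimultaneousTypeEv` (e ⊥ π with a measure) and the eventual
crux in ranks `≥ 3` give Schanuel's conjecture. [folklore] -/
theorem schanuel_of_flagship_of_rankThreeUp :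
    ApproximationProperty → EPiSimultaneousTypeEv → EvRankThreeUp → _root_.Schanuel :=
  fun hAP hF hR => schanuel_of_anchored hAP (evAnchored_of_flagship_of_rankThreeUp hF hR)

/-! ## Hardness certificates of the skeleton's two open stubs -/

/-- **Stub 6 contains `e ⊥ π`, unconditionally.** A proof of `EvNonLWTwo` (eventual approximation type
`a < 1` at every non-Lindemann–Weierstrass free Khovanskii point of `ℂ²`) is a proof of the tree's open
conjecture `ExpOnePiAlgebraicIndependent` (`AlgebraicIndependent ℚ ![Real.exp 1, Real.pi]`): the stub
contains the flagship (`flagship_of_evNonLW_two`, the point `(1, iπ)`), and the PROVED level-one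
approximation property (`approximationPropertyDegOne_proof`, Laurent–Roy 1999 / Bugeaud 2004 Thm 8.11)
runs the PROVED eventual race `ePiRaceEv_proof`. [folklore] -/
theorem expOnePiAlgebraicIndependent_of_evNonLWTwo (hN : EvNonLWTwo) :
    Literature.NumberTheory.Transcendental.ExpOnePiAlgebraicIndependent :=
  expOnePiAlgebraicIndependent_of_degOne_of_epiSimultaneousTypeEv approximationPropertyDegOne_proof
    (flagship_of_evNonLW_two hN)

/-- **The two open stubs are the whole Diophantine side of the route**: modulo Philippon's
approximation property (`ApproximationProperty`, the route's other crux, stmt-Schanuel-6117) the stubs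
`EvNonLWTwo` and `EvRankThreeUp` give Schanuel's conjecture (the LW layer `EvLWTwo`, landed p123471, is
not even needed: the anchored family never meets it beyond the flagship). [folklore] -/
theorem schanuel_of_approximationProperty_of_stubs :
    ApproximationProperty → EvNonLWTwo → EvRankThreeUp → _root_.Schanuel :=
  fun hAP hN hR => schanuel_of_flagship_of_rankThreeUp hAP (flagship_of_evNonLW_two hN) hR

end Summit.Schanuel.Schanuel.Cruxes.KhovanskiiApproxTypeEv.AnchoredReduction

end
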